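import Summits.QuantumFields.YangMills.Theorems.LuscherReductionTwistedTraceScalingMehlerHermite
import HarnessLib

/-!
# C4 INNER, brick S/K interface: normalising a lattice stiff mode to the Mehler parameters — the β-INDEPENDENT ratio `r(w) = 2/(w + 2 + √(w² + 4w))`
# (lane A of S-BASE, crux `TwistedTraceScaling` stmt-QuantumFields-20203; sub-target C4, design note `pub/ym-fleet/ym-luscher-20007-p1/COARSE-DESIGN.md` §21.5 S, §21.8)

A stiff normal mode of the vacuum (Hessian eigenvalue `w > 0`, kinetic constant `β/2`) has the one-dimensional transfer kernel
`exp(−(β/4)w(x² + y²) − (β/2)(x − y)²)`, i.e. the Mehler kernel with `a = βw/4`, `b = β/2` (`…MehlerHermite`, `c² = a² + 2ab`).  Rescaling the coordinate by `t`,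
`t² = 4π/(β√(w²+4w))`, puts it in the normal form `a² + 2ab = π²` of `mehler_herm` WITHOUT changing the eigenvalue ratio
`r = b/(a+b+c) = 2/(w + 2 + √(w² + 4w))`, which is INDEPENDENT of `β`, lies in `(0,1)`, and decreases with `w`; so the stiff gap of the package is
`θ_S = 1 − r(g₀)`, `g₀ = 2 − 2cos(2π/L)` the vacuum stiff gap (`Frame.IsDiag.value_zero_or_ge_vacuum`), uniformly in `β`.
* `mehlerRatio w`, `mehlerRatio_pos`, `mehlerRatio_lt_one`, `mehlerRatio_anti` (antitone on `0 < w`);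
* ★ `mehler_normalisation`: for `β, w > 0` the scaled parameters `a = (βw/4)t²`, `b = (β/2)t²` satisfy `0 < a`, `0 < b`, `a² + 2ab = π²` and `b/(a+b+π) = mehlerRatio w`.
HONEST FRAMING: real algebra for a stub of a child of the CONDITIONAL reduction route (femto rung R2b1); not infinite volume, not a gap, not Clay.

## References
* A. Wipf, *Statistical Approach to Quantum Field Theory*, LNP 992, Springer 2021, §8.5.1 (8.57)–(8.58). [Wipf2021]
-/

set_option autoImplicit false

open Real

namespace Summit.QuantumFields.YangMills.Theorems.FemtoTransferGap.Mehler

noncomputable section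

/-- The β-independent Mehler ratio of a stiff mode of Hessian eigenvalue `w`: `r(w) = 2/(w + 2 + √(w² + 4w))`. [cite: Wipf2021, §8.5.1 (8.58)] -/
def mehlerRatio (w : ℝ) : ℝ := 2 / (w + 2 + Real.sqrt (w ^ 2 + 4 * w))

/-- `0 < r(w)` for `w ≥ 0`. [folklore] -/
theorem mehlerRatio_pos {w : ℝ} (hw : 0 ≤ w) : 0 < mehlerRatio w := by
  unfold mehlerRatio
  have : 0 ≤ Real.sqrt (w ^ 2 + 4 * w) := Real.sqrt_nonneg _
  positivity

/-- `r(w) < 1` for `w > 0`. [folklore] -/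
theorem mehlerRatio_lt_one {w : ℝ} (hw : 0 < w) : mehlerRatio w < 1 := by
  unfold mehlerRatio
  have hs : 0 ≤ Real.sqrt (w ^ 2 + 4 * w) := Real.sqrt_nonneg _
  rw [div_lt_one (by positivity)]
  linarith

/-- `r(w) ≤ 1` for `w ≥ 0`. [folklore] -/
theorem mehlerRatio_le_one {w : ℝ} (hw : 0 ≤ w) : mehlerRatio w ≤ 1 := by
  unfold mehlerRatio
  have hs : 0 ≤ Real.sqrt (w ^ 2 + 4 * w) := Real.sqrt_nonneg _
  rw [div_le_one (by positivity)]
  linarith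

/-- `r` is antitone on `[0, ∞)`: stiffer modes have smaller ratios, so `max_k r(w_k) = r(min_k w_k)`. [folklore] -/
theorem mehlerRatio_anti {w w' : ℝ} (hw : 0 ≤ w) (hww' : w ≤ w') : mehlerRatio w' ≤ mehlerRatio w := by
  unfold mehlerRatio
  have hs : 0 ≤ Real.sqrt (w ^ 2 + 4 * w) := Real.sqrt_nonneg _
  have hmono : Real.sqrt (w ^ 2 + 4 * w) ≤ Real.sqrt (w' ^ 2 + 4 * w') := Real.sqrt_le_sqrt (by nlinarith)
  exact div_le_div_of_nonneg_left (by norm_num) (by positivity) (by linarith)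

/-- ★ **Normalisation to `a² + 2ab = π²`.**  For `β > 0`, `w > 0`, with `t² = 4π/(β√(w²+4w))`, `a = (βw/4)·t²`, `b = (β/2)·t²`:
`0 < a`, `0 < b`, `a² + 2ab = π²` and `b/(a + b + π) = mehlerRatio w`. [cite: Wipf2021, §8.5.1 (8.57)] -/
theorem mehler_normalisation {β w : ℝ} (hβ : 0 < β) (hw : 0 < w) :
    let t2 : ℝ := 4 * π / (β * Real.sqrt (w ^ 2 + 4 * w))
    let a : ℝ := β * w / 4 * t2
    let b : ℝ := β / 2 * t2
    0 < a ∧ 0 < b ∧ a ^ 2 + 2 * a * b = π ^ 2 ∧ b / (a + b + π) = mehlerRatio w := by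
  intro t2 a b
  have hq : 0 < w ^ 2 + 4 * w := by positivity
  have hS : 0 < Real.sqrt (w ^ 2 + 4 * w) := Real.sqrt_pos.mpr hq
  have hS2 : Real.sqrt (w ^ 2 + 4 * w) ^ 2 = w ^ 2 + 4 * w := Real.sq_sqrt hq.le
  have ht2 : 0 < t2 := by show 0 < 4 * π / (β * Real.sqrt (w ^ 2 + 4 * w)); positivity
  have ha : 0 < a := by show 0 < β * w / 4 * t2; positivity
  have hb : 0 < b := by show 0 < β / 2 * t2; positivity
  -- the key: `β √(w²+4w) · t² = 4π`
  have hkey : β * Real.sqrt (w ^ 2 + 4 * w) * t2 = 4 * π := by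
    show β * Real.sqrt (w ^ 2 + 4 * w) * (4 * π / (β * Real.sqrt (w ^ 2 + 4 * w))) = 4 * π
    field_simp
  -- `c := (β/4)√(w²+4w)·t² = π` and `c² = a² + 2ab`
  have hc : (β / 4 * Real.sqrt (w ^ 2 + 4 * w) * t2) = π := by linarith [hkey]
  have hc2 : (β / 4 * Real.sqrt (w ^ 2 + 4 * w) * t2) ^ 2 = a ^ 2 + 2 * a * b := by
    show (β / 4 * Real.sqrt (w ^ 2 + 4 * w) * t2) ^ 2 = (β * w / 4 * t2) ^ 2 + 2 * (β * w / 4 * t2) * (β / 2 * t2)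
    have : (β / 4 * Real.sqrt (w ^ 2 + 4 * w) * t2) ^ 2 = (β / 4) ^ 2 * Real.sqrt (w ^ 2 + 4 * w) ^ 2 * t2 ^ 2 := by ring
    rw [this, hS2]; ring
  refine ⟨ha, hb, by rw [← hc2, hc], ?_⟩
  -- the ratio
  rw [← hc]
  show β / 2 * t2 / (β * w / 4 * t2 + β / 2 * t2 + β / 4 * Real.sqrt (w ^ 2 + 4 * w) * t2) = mehlerRatio w
  unfold mehlerRatio
  have hden : 0 < w + 2 + Real.sqrt (w ^ 2 + 4 * w) := by positivity
  rw [div_eq_div_iff (by positivity) hden.ne']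
  ring

end

end Summit.QuantumFields.YangMills.Theorems.FemtoTransferGap.Mehler
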